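import Literature.Analysis.FluidPDE.SelfSimilarEulerBernoulliCap
import HarnessLib

/-!
# A nontrivial in-window self-similar Euler profile has a non-vortical INFLOW stagnation point

Analysis/FluidPDE proofs file (theorems only), appendix to the Eulerian treatment of
Constantin–Ignatova–Vicol 2026 (arXiv:2602.17570) §3.4.3–§3.5 for `C²` stationary self-similar Euler
profiles `(U, P)` in the window `0 < γ < ½` with the far-field bounds (3.8)
(`SelfSimilarEulerOutgoingExclusion` … `SelfSimilarEulerBernoulliCap`). CIV's local outgoing
property (Def. 3.7) asks `V(y)·(y − y_*) ≥ c_*|y − y_*|² ≥ 0` near every stagnation point `y_*` of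
`V = γ(y − c) + U`; the tree's analyticity-free Thm 3.10 says a nontrivial in-window profile
violates it. This file says HOW, at a specific node:

> **Theorem** (`IsSelfSimilarEulerProfile.exists_nonvortical_inflow_stagnation`). Let `0 < γ < ½`
> and let `(U, P)` be a NONTRIVIAL `C²` profile with (3.8). Then there is a stagnation point `z` of
> `V` which is (i) NON-vortical, `curl U(z) = 0` (so `DU(z)` is the symmetric strain); (ii)
> stretching: `⟪DU(z) w, w⟫ ≥ |w|²` for some `w ≠ 0`; (iii) linearly INFLOWING in some direction:
> `⟪DV(z) h, h⟫ = γ|h|² + ⟪DU(z) h, h⟫ < 0` for some `h` — the outgoing inequality fails at `z`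
> already to first order; and (iv) the vorticity vanishes on the whole Bernoulli superlevel set
> `{ℋ > ℋ(z)}`.

The point `z` is the bad stagnation point of maximal Bernoulli value: above its level all nodes
are good, so `curl U ≡ 0` there (localisation); `z` is not a local maximum of `ℋ` (a local-max node
is good, `SelfSimilarEulerBernoulliLocalMax`), hence lies in the closure of `{ℋ > ℋ(z)}` and is
non-vortical by continuity; `tr DU(z) = 0` with an eigenvalue `≥ 1` forces a direction with
`⟪DU(z) h, h⟫ < −γ|h|²` (`inner_apply_self_le_trace_sub_mul`).

## References

* P. Constantin, M. Ignatova, V. Vicol, arXiv:2602.17570 (2026), §3.5 Def. 3.7, Thm. 3.8,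
  Thm. 3.10. [ConstantinIgnatovaVicol2026Putative]
-/

noncomputable section

open Set Filter Topology InnerProductSpace Metric
open scoped RealInnerProductSpace

namespace Literature.Analysis.FluidPDE

namespace IsSelfSimilarEulerProfile

variable {γ : ℝ} {c : EuclideanSpace ℝ (Fin 3)}
  {U : EuclideanSpace ℝ (Fin 3) → EuclideanSpace ℝ (Fin 3)} {P : EuclideanSpace ℝ (Fin 3) → ℝ}

/-- **The top bad stagnation point is a non-vortical inflow saddle.** For `0 < γ < ½` and a
nontrivial `C²` profile with the far-field bounds (3.8) there is a stagnation point `z` of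
`V = γ(y−c) + U` with `curl U z = 0`, a stretching direction `⟪DU(z) w, w⟫ ≥ |w|²` (`w ≠ 0`), an
inflow direction `γ|h|² + ⟪DU(z) h, h⟫ < 0`, and `curl U = 0` on `{ℋ > ℋ(z)}`. In particular CIV's
outgoing inequality (Def. 3.7) fails at `z` to first order. [cite: ConstantinIgnatovaVicol2026Putative, §3.5 Def. 3.7 / Thm. 3.10 (sharpened; not in print)] -/
theorem exists_nonvortical_inflow_stagnation (h : IsSelfSimilarEulerProfile γ c U P)
    (hγ : 0 < γ) (hγ2 : γ < 1 / 2) {C : ℝ} (hfar : HasSelfSimilarFarFieldWith γ c C U)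
    (hU : U ≠ 0) :
    ∃ z ∈ selfSimilarNodalSet γ c U, curl U z = 0 ∧
      (∃ w : EuclideanSpace ℝ (Fin 3), w ≠ 0 ∧ ‖w‖ ^ 2 ≤ ⟪fderiv ℝ U z w, w⟫) ∧
      (∃ v : EuclideanSpace ℝ (Fin 3), γ * ‖v‖ ^ 2 + ⟪fderiv ℝ U z v, v⟫ < 0) ∧
      ∀ y, selfSimilarBernoulli γ c U P z < selfSimilarBernoulli γ c U P y → curl U y = 0 := by
  set Hb : EuclideanSpace ℝ (Fin 3) → ℝ := selfSimilarBernoulli γ c U P with hHbdef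
  have hU2 : ContDiff ℝ 2 U := h.contDiff_velocity
  have hDUc : Continuous (fderiv ℝ U) := hU2.continuous_fderiv (by norm_num)
  have hHc : Continuous Hb := h.contDiff_selfSimilarBernoulli.continuous
  have hΩc : Continuous (curl U) := (contDiff_curl (n := 1) (by exact_mod_cast hU2)).continuous
  -- the compact set of bad stagnation points
  set N : Set (EuclideanSpace ℝ (Fin 3)) := selfSimilarNodalSet γ c U with hNdef
  have hNc : IsCompact N := hfar.isCompact_selfSimilarNodalSet hγ hU2.continuous
  set S : Set (EuclideanSpace ℝ (Fin 3)) := sphere 0 1 with hSdef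
  have hSc : IsCompact S := isCompact_sphere 0 1
  set F : EuclideanSpace ℝ (Fin 3) × EuclideanSpace ℝ (Fin 3) → ℝ :=
    fun p => ⟪fderiv ℝ U p.1 p.2, p.2⟫ with hFdef
  have hFc : Continuous F := by
    have h1 : Continuous fun p : EuclideanSpace ℝ (Fin 3) × EuclideanSpace ℝ (Fin 3) =>
        fderiv ℝ U p.1 p.2 :=
      (hDUc.comp continuous_fst).clm_apply continuous_snd
    exact h1.inner continuous_snd
  set Bad2 : Set (EuclideanSpace ℝ (Fin 3) × EuclideanSpace ℝ (Fin 3)) :=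
    (N ×ˢ S) ∩ {p | 1 ≤ F p} with hBad2
  have hBad2c : IsCompact Bad2 :=
    (hNc.prod hSc).inter_right (isClosed_le continuous_const hFc)
  set Bad : Set (EuclideanSpace ℝ (Fin 3)) := Prod.fst '' Bad2 with hBad
  have hBadc : IsCompact Bad := hBad2c.image continuous_fst
  -- a node outside `Bad` is good (pointwise)
  have hgood_of : ∀ z ∈ N, z ∉ Bad → ∀ w : EuclideanSpace ℝ (Fin 3), w ≠ 0 →
      ⟪fderiv ℝ U z w, w⟫ < ‖w‖ ^ 2 := by
    intro z hz hzB w hw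
    by_contra hle
    have hle' : ‖w‖ ^ 2 ≤ ⟪fderiv ℝ U z w, w⟫ := not_lt.1 hle
    have hn : ‖w‖ ≠ 0 := norm_ne_zero_iff.2 hw
    set e : EuclideanSpace ℝ (Fin 3) := ‖w‖⁻¹ • w with he
    have he1 : ‖e‖ = 1 := by rw [he, norm_smul, norm_inv, norm_norm, inv_mul_cancel₀ hn]
    have heS : e ∈ S := by simpa [hSdef] using he1
    have hFe : 1 ≤ F (z, e) := by
      simp only [hFdef]
      rw [he, map_smul, inner_smul_left, inner_smul_right, conj_trivial]
      have hpos : 0 < ‖w‖ ^ 2 := pow_pos (norm_pos_iff.2 hw) 2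
      rw [← mul_assoc, ← mul_inv, ← sq, inv_mul_eq_div, le_div_iff₀ hpos, one_mul]
      exact hle'
    exact hzB ⟨(z, e), ⟨⟨hz, heS⟩, hFe⟩, rfl⟩
  -- `Bad` is nonempty: the stretching theorem gives a bad node
  obtain ⟨z₀, hz₀, w₀, hw₀, hbad₀⟩ := h.exists_stagnation_stretching_ge_one hγ hγ2 ⟨C, hfar⟩ hU
  have hBne : Bad.Nonempty := by
    refine ⟨z₀, ?_⟩
    by_contra hzB
    have := hgood_of z₀ hz₀ hzB w₀ hw₀
    linarith
  -- the top bad node `z`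
  obtain ⟨z, hzBad, hzmax⟩ := hBadc.exists_isMaxOn hBne hHc.continuousOn
  obtain ⟨⟨z', w⟩, ⟨⟨hzN, hwS⟩, hFzw⟩, hzz'⟩ := hzBad
  have hzz : z' = z := hzz'
  subst hzz
  have hw1 : ‖w‖ = 1 := by simpa [hSdef] using hwS
  have hw0 : w ≠ 0 := by rw [← norm_ne_zero_iff, hw1]; exact one_ne_zero
  have hFw : 1 ≤ ⟪fderiv ℝ U z' w, w⟫ := hFzw
  -- (iv) above the level `ℋ z'` every node is good, so the vorticity vanishes there
  have hcap : ∀ y, Hb z' < Hb y → curl U y = 0 := by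
    intro y hy
    set t' : ℝ := (Hb z' + Hb y) / 2 with ht'
    have ht't : Hb z' < t' := by rw [ht']; linarith
    have ht'y : t' < Hb y := by rw [ht']; linarith
    have hnode : ∀ x ∈ selfSimilarNodalSet γ c U, t' ≤ selfSimilarBernoulli γ c U P x →
        ∀ v : EuclideanSpace ℝ (Fin 3), v ≠ 0 → ⟪fderiv ℝ U x v, v⟫ < ‖v‖ ^ 2 := by
      intro x hx hxt' v hv
      refine hgood_of x hx (fun hxB => ?_) v hv
      have h1 : Hb x ≤ Hb z' := hzmax hxB
      have h2 : (Hb x : ℝ) = selfSimilarBernoulli γ c U P x := rfl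
      linarith
    exact h.curl_eq_zero_on_bernoulliSuperlevel_of_hasSelfSimilarFarField hγ hγ2 hfar t' hnode y ht'y
  -- (i) `z'` is not a local maximum of `ℋ` (a local-max node would be good), hence non-vortical
  have hnotmax : ¬ IsLocalMax Hb z' := by
    intro hloc
    have hb := h.inner_fderiv_le_of_isLocalMax_selfSimilarBernoulli hγ2 hzN hloc w
    rw [hw1, one_pow, mul_one] at hb
    linarith
  have hΩ : curl U z' = 0 := by
    -- `z'` lies in the closure of `{ℋ > ℋ z'}`, on which `curl U = 0`
    have hfreq : ∃ᶠ y in 𝓝 z', Hb z' < Hb y := by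
      have : ¬ ∀ᶠ y in 𝓝 z', Hb y ≤ Hb z' := hnotmax
      simpa [Filter.not_eventually, not_le] using this
    have hmem : z' ∈ closure {y | curl U y = 0} := by
      rw [mem_closure_iff_frequently]
      exact hfreq.mono fun y hy => hcap y hy
    have hcl : IsClosed {y : EuclideanSpace ℝ (Fin 3) | curl U y = 0} :=
      isClosed_eq hΩc continuous_const
    rw [hcl.closure_eq] at hmem
    exact hmem
  -- (iii) an inflow direction: otherwise `⟪DU h, h⟫ ≥ -γ|h|²` for all `h`, and the trace bound
  -- would give `⟪DU w, w⟫ ≤ 2γ < 1`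
  have hinflow : ∃ v : EuclideanSpace ℝ (Fin 3), γ * ‖v‖ ^ 2 + ⟪fderiv ℝ U z' v, v⟫ < 0 := by
    by_contra hcon
    push Not at hcon
    have hq : ∀ v : EuclideanSpace ℝ (Fin 3), -γ * ‖v‖ ^ 2 ≤ ⟪fderiv ℝ U z' v, v⟫ := by
      intro v; have := hcon v; linarith
    have htr := inner_apply_self_le_trace_sub_mul hq w
    have hdiv : LinearMap.trace ℝ _ (fderiv ℝ U z' :
        EuclideanSpace ℝ (Fin 3) →ₗ[ℝ] EuclideanSpace ℝ (Fin 3)) = 0 := h.divFree z'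
    rw [hdiv, finrank_euclideanSpace, Fintype.card_fin, hw1] at htr
    norm_num at htr
    linarith
  exact ⟨z', hzN, hΩ, ⟨w, hw0, by rw [hw1, one_pow]; exact hFw⟩, hinflow, hcap⟩

end IsSelfSimilarEulerProfile

end Literature.Analysis.FluidPDE

end
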